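import Mathlib
import Literature.Probability.PointProcesses.LensConsistentLaw
import HarnessLib

/-!
# Weak duality between pattern-pointwise transfer certificates and lens-consistent rooted laws

The dual objects of the finite-level transfer/marginal program on rooted point patterns (route
`AtomisticToContinuum/Crystallization/FrustrationRangeCertificates`, crux `PatternPricedCertificates`,
stub `stub_patternCertificates` of its birth line) are **pattern-pointwise certificates**: a constant
`c`, a price `κ` on a defect functional `b`, a site functional `F` and a transfer rule
`g : E → Finset E → Finset E → ℝ` at inner radius `r` with

  `c + κ · b S ≤ F S + T_g(S)` for every `(δ, L)`-admissible rooted pattern `S`,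

where `T_g(S) = Σ_{v ∈ lens r L S} [g(v, B_r S, B_r(reroot S v)) − g(−v, B_r(reroot S v), B_r S)]` is
verbatim the integrand of the finite-level mass-transport identity (MT_{L,r}) defining
`LensConsistentLaw` (this directory, `LensConsistentLaw.lean`). The primal objects are the
level-`(L, r)` lens-consistent rooted laws `μ` (continuum Kaburagi–Kanamori polytope).

This file proves **weak duality** between the two: the transfer term is centred under every
lens-consistent law (`LensConsistentLaw.expect_lensTransfer_eq_zero`, which is (MT_{L,r}) read as
`𝔼[received] = 𝔼[sent]`), hence a pattern-pointwise certificate gives `c + κ·𝔼_μ[b] ≤ 𝔼_μ[F]`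
for every lens-consistent `μ` (`LensConsistentLaw.weakDuality`; `weakDuality_ite` is the literal
`if good then 0 else κ` form used by the route, giving `c + κ·μ(bad) ≤ 𝔼_μ[½ h_L]` for the
`L`-truncated one-centre energy `h_L(S) = Σ_{v ∈ S} V ‖v‖`), and the vacuum test
(`patternCertificate_vacuum_le`: the empty pattern forces `c + κ·1[bad ∅] ≤ 0`). In words: the
certified constant is at most the value `inf_μ (𝔼_μ[F] − κ 𝔼_μ[b])` of the primal level-`(L, r)`
program, so a lens-consistent pseudo-law with small truncated energy and large defect mass refutes
every certificate claim at that level, and any existence proof of a certificate must bound the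
primal program from below. This is the standard weak half of LP duality for m-potential /
score-function certificates (Holsztyński–Sławny 1978 §3; Lagarias 2002 Thm 2.1) in the
mass-transport formulation of Aldous–Lyons; the configuration-level analogue (zero-sum transfers on
finite configurations) is `Literature.MathematicalPhysics.StatisticalMechanics.sum_transferSum_eq_zero`
/ `IsTransferCertificate.mul_le_sum` in `TransferLevelValue.lean`.

Everything is generic in the normed group `E` and in the functionals; all statements are proved.
NOT here: strong duality / level convergence (open requests of the route). [folklore]
-/

noncomputable section

open scoped BigOperators Classical

namespace Literature.Probability.PointProcesses

variable {E : Type*} [NormedAddCommGroup E]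

/-- Expectation of a difference of pattern functionals is the difference of the expectations.
[folklore] -/
theorem PatternLaw.expect_sub (μ : PatternLaw E) (F G : Finset E → ℝ) :
    μ.expect (fun P => F P - G P) = μ.expect F - μ.expect G := by
  simp only [PatternLaw.expect_eq_sum, mul_sub, Finset.sum_sub_distrib]

variable [DecidableEq E] {δ r L : ℝ}

namespace LensConsistentLaw

/-- **The transfer term is centred under every lens-consistent law**: the expectation of
`T_g(S) = Σ_{v ∈ lens r L S} [g(v, B_r S, B_r(reroot S v)) − g(−v, B_r(reroot S v), B_r S)]`
vanishes — (MT_{L,r}) (`massTransport_expect`) read as `𝔼[received] = 𝔼[sent]`.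
[cite: AldousLyons2007, §2 (Mass-Transport Principle)] -/
theorem expect_lensTransfer_eq_zero (μ : LensConsistentLaw E δ r L)
    (g : E → Finset E → Finset E → ℝ) :
    μ.expect (fun S => ∑ v ∈ lens r L S,
      (g v (ballPattern r S) (ballPattern r (reroot S v)) -
        g (-v) (ballPattern r (reroot S v)) (ballPattern r S))) = 0 := by
  have h := μ.massTransport_expect g
  have hsplit : (fun S => ∑ v ∈ lens r L S,
      (g v (ballPattern r S) (ballPattern r (reroot S v)) -
        g (-v) (ballPattern r (reroot S v)) (ballPattern r S))) =
      fun S => (∑ v ∈ lens r L S, g v (ballPattern r S) (ballPattern r (reroot S v))) -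
        ∑ v ∈ lens r L S, g (-v) (ballPattern r (reroot S v)) (ballPattern r S) := by
    funext S
    exact Finset.sum_sub_distrib _ _
  rw [hsplit, PatternLaw.expect_sub, h, sub_self]

/-- **Weak duality at the pattern level.** If `c + κ · b S ≤ F S + T_g(S)` for every
`(δ, L)`-admissible rooted pattern `S` (a pattern-pointwise priced certificate with defect
functional `b`, site functional `F`, price `κ` and transfer rule `g` at inner radius `r`), then
`c + κ · 𝔼_μ[b] ≤ 𝔼_μ[F]` for every level-`(L, r)` lens-consistent rooted law `μ` at separation `δ`:
the law is supported on admissible patterns and the transfer term is centred. [folklore] -/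
theorem weakDuality (μ : LensConsistentLaw E δ r L) (F b : Finset E → ℝ) (c κ : ℝ)
    (g : E → Finset E → Finset E → ℝ)
    (h : ∀ S : Finset E, IsRootedPattern δ L S →
      c + κ * b S ≤ F S + ∑ v ∈ lens r L S,
        (g v (ballPattern r S) (ballPattern r (reroot S v)) -
          g (-v) (ballPattern r (reroot S v)) (ballPattern r S))) :
    c + κ * μ.expect b ≤ μ.expect F := by
  have hmono : μ.expect (fun S => c + κ * b S) ≤
      μ.expect (fun S => F S + ∑ v ∈ lens r L S,
        (g v (ballPattern r S) (ballPattern r (reroot S v)) -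
          g (-v) (ballPattern r (reroot S v)) (ballPattern r S))) :=
    μ.expect_mono fun S hS => h S (μ.supported S hS)
  rw [μ.expect_add, μ.expect_add, μ.expect_const, μ.expect_const_mul,
    expect_lensTransfer_eq_zero, add_zero] at hmono
  exact hmono

/-- Weak duality in the literal `if`-form of the route's certificates: a certificate
`c + (if good S then 0 else κ) ≤ (Σ_{v ∈ S} V ‖v‖)/2 + T_g(S)` on all admissible patterns gives
`c + κ · μ(bad) ≤ 𝔼_μ[½ h_L]` for every lens-consistent law `μ`, where `μ(bad) = 𝔼_μ[1 − 1[good]]`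
and `h_L(S) = Σ_{v ∈ S} V ‖v‖` is the `L`-truncated one-centre energy. [folklore] -/
theorem weakDuality_ite (μ : LensConsistentLaw E δ r L) (good : Finset E → Prop)
    (V : ℝ → ℝ) (c κ : ℝ) (g : E → Finset E → Finset E → ℝ)
    (h : ∀ S : Finset E, IsRootedPattern δ L S →
      c + (if good S then 0 else κ) ≤ (∑ v ∈ S, V ‖v‖) / 2 + ∑ v ∈ lens r L S,
        (g v (ballPattern r S) (ballPattern r (reroot S v)) -
          g (-v) (ballPattern r (reroot S v)) (ballPattern r S))) :
    c + κ * μ.expect (fun S => if good S then 0 else 1) ≤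
      μ.expect (fun S => (∑ v ∈ S, V ‖v‖) / 2) := by
  refine weakDuality μ (fun S => (∑ v ∈ S, V ‖v‖) / 2)
    (fun S => if good S then 0 else 1) c κ g fun S hS => ?_
  have h1 := h S hS
  by_cases hg : good S
  · rw [if_pos hg] at h1
    rw [if_pos hg, mul_zero]
    exact h1
  · rw [if_neg hg] at h1
    rw [if_neg hg, mul_one]
    exact h1

end LensConsistentLaw

/-- **The vacuum test.** The empty pattern is admissible and carries no energy and no transfers,
so every pattern-pointwise certificate in `if`-form has `c + (if good ∅ then 0 else κ) ≤ 0`: the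
certified constant is non-positive as soon as `κ ≥ 0` (the isolated root; cf.
`transferLevelValue_nonpos` on the configuration side). [folklore] -/
theorem patternCertificate_vacuum_le (good : Finset E → Prop) (V : ℝ → ℝ) (c κ : ℝ)
    (g : E → Finset E → Finset E → ℝ)
    (h : ∀ S : Finset E, IsRootedPattern δ L S →
      c + (if good S then 0 else κ) ≤ (∑ v ∈ S, V ‖v‖) / 2 + ∑ v ∈ lens r L S,
        (g v (ballPattern r S) (ballPattern r (reroot S v)) -
          g (-v) (ballPattern r (reroot S v)) (ballPattern r S))) :
    c + (if good (∅ : Finset E) then 0 else κ) ≤ 0 := by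
  have h0 := h ∅ (isRootedPattern_empty δ L)
  simpa using h0

end Literature.Probability.PointProcesses

end
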